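import Mathlib

/-!
# `Balaban1983to89.B12LaurentSplit522` — [Balaban1987RG1] §5 p. 294: the one-variable Laurent splitting
`f(z) = g⁺(z) + g⁻(z⁻¹)` of a function analytic on a ring, its uniqueness under the printed normalizations, and the
three transformation laws — PROVED (Cauchy's formula for an annulus)

HONEST FRAMING (cell `lit-balaban`, verbatim): statement-level skeleton of published theorems with citation tags; proofs where landed; nothing here is a claim about the Yang–Mills mass gap.

CITATION HEADER.  T. Bałaban, *Renormalization group approach to lattice gauge field theories. I. Generation of
effective actions in a small field approximation and a coupling constant renormalization in four dimensions*,
Commun. Math. Phys. **109** (1987) 249–301, doi:10.1007/bf01215223 [Balaban1987RG1] (cell paper B12; held text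
`paper:balaban1987-cmp109-rg-i-small-field`, journal page = PDF page + 248; p. 294 read from the page render
`b2b-balaban-ref1/pages/1987-cmp109-rg-I-small-field/…-p046-x2.png`).  Unit `lit-balaban-r09` gen 2 (Phase 2),
SKELETON row `B12.Eq5.22-5.26` (before this file: the (5.26) sums `B12Sec5Algebra.F11/F12/F21`, `B12Rep526.rep526`
and the one-variable operators `B12Sec5Algebra.opS/opM/opN` were typed; the analytic DECOMPOSITION step was not).

WHAT IS PRINTED (verbatim, p. 294 [PDF 46], re-read on the render for v1.1).  *«Now, a given function f(z)
analytic on the ring {e^{−δ₁} < |z| < e^{δ₁}} can be represented as f(z) = g⁺(z) + g⁻(z⁻¹), where g⁺(z), g⁻(z)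
are analytic on the disc {|z| < e^{δ₁}}. This representation is obtained by taking regular and singular parts of
the Laurent expansion. It is unique up to an additive constant, and it can be made unique requiring some
normalization conditions. These conditions depend on the property (5.19). Consider cases with one component of ε
equal to −1. If the index of this component is different from μ, ν, then the transformation law in the one
variable is f(z⁻¹) = f(z). The normalization condition g⁺(0) = g⁻(0) implies then g⁻(z) = g⁺(z), and we have the
representation f(z) = g(z) + g(z⁻¹), g(z) = g⁺(z). If the index is equal to μ, then the transformation law is
f(z⁻¹) = −z⁻¹f(z). The normalization condition g⁺(0) = 0 implies g⁻(z) = −z⁻¹g⁺(z), and we have f(z) = g(z) −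
zg(z⁻¹). Finally, if the index is equal to ν, then f(z⁻¹) = −zf(z), and the normalization condition g⁻(0) = 0
implies g⁻(z) = −zg⁺(z), f(z) = g(z) − z⁻¹g(z⁻¹). Applying these representations to the functions f_{μν}(z), to
each variable separately, we obtain [(5.22)]»*; and, three sentences earlier on the same page, *«We obtain such a
representation using some simple expansion connected with the Laurent series expansion. It was used already in [43]
for a similar purpose.»* ([43] = K. Gawędzki, A. Kupiainen, *Massless lattice φ⁴₄ theory: rigorous control of a
renormalizable asymptotically free model*, Commun. Math. Phys. **99** (1985) 197–252 — reference list p. 300.)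
ERRATUM v1 → v1.1 (REFEREE-P2 ref-5 gen 3, 2026-08-21T01:14Z, SIGNED with one docstring erratum): v1 labelled a
PARAPHRASE of this passage «verbatim» and mis-attributed [43]; v1.1 replaces the paragraph by the printed text and
corrects the attribution.  DOCSTRINGS ONLY — every Lean declaration of v1 (p242586, commit 4a7c83ebd9c6) is
byte-unchanged.

WHAT THIS MODULE PROVES (one complex variable; `R = e^{δ₁} > 1`, the ring `R⁻¹ < |z| < R`).
* `circleIntegral_inv_radius` — the inversion `z ↦ z⁻¹` on circles: `∮_{C(0,r)} F(z)dz = ∮_{C(0,r⁻¹)} ζ⁻²F(ζ⁻¹)dζ`.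
* `cauchy_annulus` — **Cauchy's formula for an annulus**: for `f` holomorphic on the ring and `r₁ < |w| < r₂`
  inside it, `f(w) = (2πi)⁻¹∮_{C(0,r₂)} f(z)/(z−w) dz − (2πi)⁻¹∮_{C(0,r₁)} f(z)/(z−w) dz`.
* `gPlus`, `gMinus` and **`laurent_split`** — EXISTENCE: with `g⁺(w) = (2πi)⁻¹∮_{C(0,r₂)} f(z)/(z−w) dz` and
  `g⁻(u) = u·(2πi)⁻¹∮_{C(0,r₁⁻¹)} ζ⁻¹f(ζ⁻¹)/(ζ−u) dζ` (normalization `g⁻(0) = 0`), `f(w) = g⁺(w) + g⁻(w⁻¹)` on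
  `r₁ < |w| < r₂`, `g⁺` holomorphic on `|w| < r₂`, `g⁻` on `|u| < r₁⁻¹` (`differentiableOn_gPlus/gMinus`).
* `laurent_unique` — UNIQUENESS «up to a constant»: if `g⁺(z) + g⁻(z⁻¹) = 0` on the ring with `g^±` holomorphic
  on the disc `|z| < R`, then `g⁺ ≡ c`, `g⁻ ≡ −c` (Liouville, gluing as in `B12Sec5Algebra.vanish_of_odd_under_inversion`);
  hence each printed normalization fixes the decomposition (`laurent_unique_of_norm*`).
* THE THREE LAWS: `law_S` (`f(z⁻¹) = f(z)`, `g⁺(0) = g⁻(0)` ⇒ `g⁻ = g⁺`), `law_M` (`f(z⁻¹) = −z⁻¹f(z)`, `g⁺(0) = 0`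
  ⇒ `g⁺(z) = −z g⁻(z)`, i.e. `g⁻(z) = −z⁻¹g⁺(z)`), `law_N` (`f(z⁻¹) = −zf(z)`, `g⁻(0) = 0` ⇒ `g⁻(z) = −zg⁺(z)`).
TRANSCRIPT NOTE (T1).  The existence statement is proved with the radii of the two circles STRICTLY inside the
ring (`R⁻¹ < r₁ < r₂ < R`): `g⁺` is then holomorphic on `|w| < r₂` and `g⁻` on `|u| < r₁⁻¹`, and the decomposition
holds on `r₁ < |w| < r₂`; by uniqueness these decompositions are compatible as `r₁ ↓ R⁻¹`, `r₂ ↑ R`, which gives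
the printed disc `|z| < e^{δ₁}` — the patching itself is not typed here (every use in §5 is at fixed radii).
Nothing of the series is asserted; no `Prop` fact; axioms standard.
-/

namespace Literature.MathematicalPhysics.QuantumFieldTheory.Balaban1983to89.B12LaurentSplit522

open Complex MeasureTheory Set Metric Filter
open scoped Real Topology

noncomputable section

/-! ## 1. Inversion on circles -/

/-- `(circleMap 0 r⁻¹ θ)⁻¹ = circleMap 0 r (−θ)`: inversion maps the circle of radius `r⁻¹` onto the circle of
radius `r`, reversing the orientation. [cite: Balaban1987RG1, §5 p.294] -/
theorem inv_circleMap_inv_radius (r θ : ℝ) : (circleMap 0 r⁻¹ θ)⁻¹ = circleMap 0 r (-θ) := by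
  simp only [circleMap, zero_add, mul_inv, ofReal_inv, inv_inv, ofReal_neg, neg_mul, Complex.exp_neg]

/-- **Inversion on circles**: `∮_{C(0,r)} F(z) dz = ∮_{C(0,r⁻¹)} ζ⁻² F(ζ⁻¹) dζ` (substitute `z = ζ⁻¹`; the two sign
changes — from `dz = −ζ⁻²dζ` and from the reversed orientation — cancel). [cite: Balaban1987RG1, §5 p.294] -/
theorem circleIntegral_inv_radius (F : ℂ → ℂ) (r : ℝ) :
    (∮ z in C(0, r), F z) = ∮ ζ in C(0, r⁻¹), (ζ⁻¹) ^ 2 * F ζ⁻¹ := by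
  simp only [circleIntegral, deriv_circleMap, smul_eq_mul]
  -- the right integrand at `θ` is the left integrand at `−θ`
  have hpt : ∀ θ : ℝ, circleMap 0 r⁻¹ θ * I * ((circleMap 0 r⁻¹ θ)⁻¹ ^ 2 * F (circleMap 0 r⁻¹ θ)⁻¹)
      = circleMap 0 r (-θ) * I * F (circleMap 0 r (-θ)) := by
    intro θ
    rw [inv_circleMap_inv_radius]
    by_cases hr : r = 0
    · subst hr; simp [circleMap]
    have h1 : circleMap 0 r⁻¹ θ * circleMap 0 r (-θ) = 1 := by
      rw [← inv_circleMap_inv_radius, mul_inv_cancel₀]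
      exact circleMap_ne_center (inv_ne_zero hr)
    calc circleMap 0 r⁻¹ θ * I * (circleMap 0 r (-θ) ^ 2 * F (circleMap 0 r (-θ)))
        = (circleMap 0 r⁻¹ θ * circleMap 0 r (-θ)) * circleMap 0 r (-θ) * I * F (circleMap 0 r (-θ)) := by ring
      _ = circleMap 0 r (-θ) * I * F (circleMap 0 r (-θ)) := by rw [h1, one_mul]
  simp_rw [hpt]
  -- `∫₀^{2π} L(−θ) dθ = ∫_{−2π}^{0} L = ∫₀^{2π} L` by periodicity
  set L : ℝ → ℂ := fun θ => circleMap 0 r θ * I * F (circleMap 0 r θ) with hL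
  have hper : Function.Periodic L (2 * π) := by
    intro θ
    simp only [hL, periodic_circleMap 0 r θ]
  have h1 : (∫ θ in (0 : ℝ)..2 * π, L (-θ)) = ∫ θ in (-(2 * π))..0, L θ := by
    rw [intervalIntegral.integral_comp_neg]; simp
  have h2 : (∫ θ in (-(2 * π))..0, L θ) = ∫ θ in (0 : ℝ)..2 * π, L θ := by
    have := hper.intervalIntegral_add_eq (-(2 * π)) 0
    simp only [neg_add_cancel, zero_add] at this
    exact this
  change (∫ θ in (0:ℝ)..2 * π, L θ) = ∫ θ in (0:ℝ)..2 * π, L (-θ)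
  rw [h1, h2]

/-! ## 2. Cauchy's formula for an annulus -/

/-- **Cauchy's integral formula for an annulus.**  If `f` is holomorphic on the open ring `ρ₁ < |z| < ρ₂` and
`ρ₁ < r₁ < |w| < r₂ < ρ₂`, then `f(w) = (2πi)⁻¹∮_{C(0,r₂)} f(z)/(z − w) dz − (2πi)⁻¹∮_{C(0,r₁)} f(z)/(z − w) dz`
(Cauchy–Goursat on the annulus for the difference quotient `dslope f w`, then `∮_{C(0,r₂)} dz/(z−w) = 2πi`,
`∮_{C(0,r₁)} dz/(z−w) = 0`). [cite: Balaban1987RG1, §5 p.294] -/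
theorem cauchy_annulus {f : ℂ → ℂ} {ρ₁ ρ₂ r₁ r₂ : ℝ} (hρ₁ : 0 ≤ ρ₁)
    (hf : DifferentiableOn ℂ f {z : ℂ | ρ₁ < ‖z‖ ∧ ‖z‖ < ρ₂})
    (hr₁ : ρ₁ < r₁) (hr₂ : r₂ < ρ₂) {w : ℂ} (hw₁ : r₁ < ‖w‖) (hw₂ : ‖w‖ < r₂) :
    f w = (2 * π * I)⁻¹ * (∮ z in C(0, r₂), (z - w)⁻¹ * f z)
      - (2 * π * I)⁻¹ * (∮ z in C(0, r₁), (z - w)⁻¹ * f z) := by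
  have hr₁0 : 0 < r₁ := lt_of_le_of_lt hρ₁ hr₁
  have hr₁₂ : r₁ ≤ r₂ := (hw₁.trans hw₂).le
  set A : Set ℂ := {z : ℂ | ρ₁ < ‖z‖ ∧ ‖z‖ < ρ₂} with hA
  have hAo : IsOpen A := by
    rw [hA, show {z : ℂ | ρ₁ < ‖z‖ ∧ ‖z‖ < ρ₂} = {z : ℂ | ρ₁ < ‖z‖} ∩ {z | ‖z‖ < ρ₂} from rfl]
    exact (isOpen_lt continuous_const continuous_norm).inter (isOpen_lt continuous_norm continuous_const)
  have hwA : w ∈ A := ⟨hr₁.trans hw₁, hw₂.trans hr₂⟩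
  have hclosed_sub : closedBall (0 : ℂ) r₂ \ ball 0 r₁ ⊆ A := by
    intro z hz
    simp only [Set.mem_sdiff, mem_closedBall, dist_zero_right, mem_ball, not_lt] at hz
    exact ⟨hr₁.trans_le hz.2, hz.1.trans_lt hr₂⟩
  -- the difference quotient is holomorphic on `A \ {w}` and continuous on `A`
  set h : ℂ → ℂ := dslope f w with hh
  have hfw : DifferentiableAt ℂ f w := hf.differentiableAt (hAo.mem_nhds hwA)
  have hcont : ContinuousOn h A := by
    rw [hh, continuousOn_dslope (hAo.mem_nhds hwA)]
    exact ⟨hf.continuousOn, hfw⟩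
  have hdiff : ∀ z ∈ A, z ≠ w → DifferentiableAt ℂ h z := by
    intro z hz hzw
    rw [hh, differentiableAt_dslope_of_ne hzw]
    exact hf.differentiableAt (hAo.mem_nhds hz)
  -- Cauchy–Goursat on the annulus for `h`
  have hCG := Complex.circleIntegral_eq_of_differentiable_on_annulus_off_countable hr₁0 hr₁₂
    (f := h) (s := {w}) (countable_singleton w) (hcont.mono hclosed_sub)
    (fun z hz => by
      obtain ⟨⟨hz₂, hz₁⟩, hzw⟩ := hz
      simp only [mem_ball, dist_zero_right] at hz₂
      simp only [mem_closedBall, dist_zero_right, not_le] at hz₁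
      exact hdiff z ⟨hr₁.trans hz₁, hz₂.trans hr₂⟩ (by simpa using hzw))
  -- on both circles `h z = (z - w)⁻¹ * f z - (z - w)⁻¹ * f w`
  have hw_not₂ : ∀ z ∈ sphere (0 : ℂ) r₂, z ≠ w := by
    intro z hz hzw; subst hzw; simp only [mem_sphere, dist_zero_right] at hz; linarith
  have hw_not₁ : ∀ z ∈ sphere (0 : ℂ) r₁, z ≠ w := by
    intro z hz hzw; subst hzw; simp only [mem_sphere, dist_zero_right] at hz; linarith
  have hexp : ∀ z : ℂ, z ≠ w → h z = (z - w)⁻¹ * f z - (z - w)⁻¹ * f w := by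
    intro z hzw
    rw [hh, dslope_of_ne f hzw, slope_def_field, div_eq_inv_mul, mul_sub]
  have hI₂ : (∮ z in C(0, r₂), h z) = (∮ z in C(0, r₂), (z - w)⁻¹ * f z) - (2 * π * I) * f w := by
    rw [circleIntegral.integral_congr (hr₁0.le.trans hr₁₂) fun z hz => hexp z (hw_not₂ z hz)]
    have hc₁ : CircleIntegrable (fun z => (z - w)⁻¹ * f z) 0 r₂ := by
      refine ContinuousOn.circleIntegrable (hr₁0.le.trans hr₁₂) ?_
      refine ContinuousOn.mul ?_ (hf.continuousOn.mono fun z hz => hclosed_sub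
        ⟨sphere_subset_closedBall hz, fun h' => ?_⟩)
      · exact ContinuousOn.inv₀ (continuousOn_id.sub continuousOn_const)
          fun z hz => sub_ne_zero.2 (hw_not₂ z hz)
      · simp only [mem_sphere, dist_zero_right] at hz
        simp only [mem_ball, dist_zero_right] at h'
        linarith
    have hc₂ : CircleIntegrable (fun z => (z - w)⁻¹ * f w) 0 r₂ := by
      refine ContinuousOn.circleIntegrable (hr₁0.le.trans hr₁₂) ?_
      exact (ContinuousOn.inv₀ (continuousOn_id.sub continuousOn_const)
        fun z hz => sub_ne_zero.2 (hw_not₂ z hz)).mul continuousOn_const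
    rw [circleIntegral.integral_sub hc₁ hc₂]
    congr 1
    rw [show (fun z : ℂ => (z - w)⁻¹ * f w) = fun z => (z - w)⁻¹ • f w from rfl,
      circleIntegral.integral_smul_const, circleIntegral.integral_sub_inv_of_mem_ball
        (by simpa using hw₂), smul_eq_mul]
  have hI₁ : (∮ z in C(0, r₁), h z) = ∮ z in C(0, r₁), (z - w)⁻¹ * f z := by
    rw [circleIntegral.integral_congr hr₁0.le fun z hz => hexp z (hw_not₁ z hz)]
    have hc₁ : CircleIntegrable (fun z => (z - w)⁻¹ * f z) 0 r₁ := by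
      refine ContinuousOn.circleIntegrable hr₁0.le ?_
      refine ContinuousOn.mul ?_ (hf.continuousOn.mono fun z hz => hclosed_sub ⟨?_, ?_⟩)
      · exact ContinuousOn.inv₀ (continuousOn_id.sub continuousOn_const)
          fun z hz => sub_ne_zero.2 (hw_not₁ z hz)
      · exact (sphere_subset_closedBall.trans (closedBall_subset_closedBall hr₁₂)) hz
      · simp only [mem_sphere, dist_zero_right] at hz
        simp only [mem_ball, dist_zero_right, not_lt]
        exact hz.ge
    have hc₂ : CircleIntegrable (fun z => (z - w)⁻¹ * f w) 0 r₁ := by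
      refine ContinuousOn.circleIntegrable hr₁0.le ?_
      exact (ContinuousOn.inv₀ (continuousOn_id.sub continuousOn_const)
        fun z hz => sub_ne_zero.2 (hw_not₁ z hz)).mul continuousOn_const
    rw [circleIntegral.integral_sub hc₁ hc₂]
    -- the second integral vanishes: `z ↦ (z - w)⁻¹ f(w)` is holomorphic on the closed disc of radius `r₁`
    have hzero : (∮ z in C(0, r₁), (z - w)⁻¹ * f w) = 0 := by
      refine Complex.circleIntegral_eq_zero_of_differentiable_on_off_countable hr₁0.le (s := ∅)
        countable_empty ?_ ?_
      · refine (ContinuousOn.inv₀ (continuousOn_id.sub continuousOn_const) fun z hz => ?_).mul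
          continuousOn_const
        apply sub_ne_zero.2
        intro hzw; change z = w at hzw; rw [hzw] at hz
        simp only [mem_closedBall, dist_zero_right] at hz; linarith
      · intro z hz
        have hzw : z ≠ w := by
          intro hzw; rw [hzw] at hz
          simp only [Set.sdiff_empty, mem_ball, dist_zero_right] at hz; linarith
        exact ((differentiableAt_id.sub_const w).inv (sub_ne_zero.2 hzw)).mul (differentiableAt_const _)
    rw [hzero, sub_zero]
  rw [hI₂, hI₁] at hCG
  have h2pi : (2 * π * I : ℂ) ≠ 0 := two_pi_I_ne_zero
  have key : (2 * π * I)⁻¹ * (∮ z in C(0, r₂), (z - w)⁻¹ * f z)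
      - (2 * π * I)⁻¹ * (∮ z in C(0, r₁), (z - w)⁻¹ * f z) = (2 * π * I)⁻¹ * ((2 * π * I) * f w) := by
    rw [← hCG]; ring
  rw [key, ← mul_assoc, inv_mul_cancel₀ h2pi, one_mul]

/-! ## 3. The splitting `f(z) = g⁺(z) + g⁻(z⁻¹)`: existence -/

/-- **`g⁺`**: the Cauchy integral over the outer circle, `g⁺(w) = (2πi)⁻¹∮_{C(0,r₂)} f(z)/(z − w) dz`
(holomorphic on `|w| < r₂`). [cite: Balaban1987RG1, §5 p.294] -/
def gPlus (f : ℂ → ℂ) (r₂ : ℝ) (w : ℂ) : ℂ := (2 * π * I)⁻¹ * ∮ z in C(0, r₂), (z - w)⁻¹ * f z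

/-- **`g⁻`** (normalization `g⁻(0) = 0`): after the inversion `z = ζ⁻¹` of the inner circle,
`g⁻(u) = u·(2πi)⁻¹∮_{C(0,r₁⁻¹)} ζ⁻¹f(ζ⁻¹)/(ζ − u) dζ` (holomorphic on `|u| < r₁⁻¹`). [cite: Balaban1987RG1, §5 p.294] -/
def gMinus (f : ℂ → ℂ) (r₁ : ℝ) (u : ℂ) : ℂ :=
  u * ((2 * π * I)⁻¹ * ∮ ζ in C(0, r₁⁻¹), (ζ - u)⁻¹ * (ζ⁻¹ * f ζ⁻¹))

/-- The normalization «g⁻(0) = 0». [cite: Balaban1987RG1, §5 p.294] -/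
@[simp] theorem gMinus_zero (f : ℂ → ℂ) (r₁ : ℝ) : gMinus f r₁ 0 = 0 := by simp [gMinus]

/-- The inner-circle term of Cauchy's formula IS `g⁻(w⁻¹)`:
`−(2πi)⁻¹∮_{C(0,r₁)} f(z)/(z − w) dz = g⁻(w⁻¹)` for `|w| > r₁ > 0` (inversion on the circle and the identity
`ζ⁻²(ζ⁻¹ − w)⁻¹ = −w⁻¹ζ⁻¹(ζ − w⁻¹)⁻¹`). [cite: Balaban1987RG1, §5 p.294] -/
theorem inner_eq_gMinus (f : ℂ → ℂ) {r₁ : ℝ} (hr₁ : 0 < r₁) {w : ℂ} (hw : r₁ < ‖w‖) :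
    -((2 * π * I)⁻¹ * ∮ z in C(0, r₁), (z - w)⁻¹ * f z) = gMinus f r₁ w⁻¹ := by
  unfold gMinus
  rw [circleIntegral_inv_radius (fun z => (z - w)⁻¹ * f z) r₁]
  have hw0 : w ≠ 0 := by intro h; rw [h, norm_zero] at hw; linarith
  have hpt : ∀ ζ ∈ sphere (0 : ℂ) r₁⁻¹,
      (ζ⁻¹) ^ 2 * ((ζ⁻¹ - w)⁻¹ * f ζ⁻¹) = (-w⁻¹) * ((ζ - w⁻¹)⁻¹ * (ζ⁻¹ * f ζ⁻¹)) := by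
    intro ζ hζ
    simp only [mem_sphere, dist_zero_right] at hζ
    have hζ0 : ζ ≠ 0 := by
      intro h; rw [h, norm_zero] at hζ; exact (inv_pos.2 hr₁).ne hζ
    have hζw : ζ⁻¹ ≠ w := by
      intro h
      have : ‖ζ⁻¹‖ = ‖w‖ := by rw [h]
      rw [norm_inv, hζ, inv_inv] at this
      linarith
    have h1 : ζ⁻¹ - w ≠ 0 := sub_ne_zero.2 hζw
    have h2 : ζ - w⁻¹ ≠ 0 := by
      intro h
      apply hζw
      rw [sub_eq_zero] at h
      rw [h, inv_inv]
    have h3 : 1 - ζ * w ≠ 0 := by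
      have : 1 - ζ * w = ζ * (ζ⁻¹ - w) := by rw [mul_sub, mul_inv_cancel₀ hζ0]
      rw [this]; exact mul_ne_zero hζ0 h1
    have e1 : (ζ⁻¹ - w)⁻¹ = ζ * (1 - ζ * w)⁻¹ := by
      rw [show ζ⁻¹ - w = ζ⁻¹ * (1 - ζ * w) by rw [mul_sub, mul_one, ← mul_assoc, inv_mul_cancel₀ hζ0, one_mul],
        mul_inv, inv_inv]
    have e2 : (ζ - w⁻¹)⁻¹ = -w * (1 - ζ * w)⁻¹ := by
      rw [show ζ - w⁻¹ = (-w⁻¹) * (1 - ζ * w) by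
        rw [neg_mul, mul_sub, mul_one, ← mul_assoc, neg_sub]
        rw [show w⁻¹ * ζ * w = ζ * (w⁻¹ * w) by ring, inv_mul_cancel₀ hw0, mul_one],
        mul_inv, inv_neg, inv_inv]
    rw [e1, e2]
    field_simp
  rw [circleIntegral.integral_congr (inv_pos.2 hr₁).le hpt, circleIntegral.integral_const_mul]
  ring

/-- **EXISTENCE of the Laurent splitting** (p. 294 «a given function f(z) analytic on the ring … can be represented
as f(z) = g⁺(z) + g⁻(z⁻¹)»): for `f` holomorphic on the open ring `ρ₁ < |z| < ρ₂` and radii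
`ρ₁ < r₁ < |w| < r₂ < ρ₂`, `f(w) = g⁺(w) + g⁻(w⁻¹)` with `g⁺ = gPlus f r₂`, `g⁻ = gMinus f r₁`.
[cite: Balaban1987RG1, §5 p.294] -/
theorem laurent_split {f : ℂ → ℂ} {ρ₁ ρ₂ r₁ r₂ : ℝ} (hρ₁ : 0 ≤ ρ₁)
    (hf : DifferentiableOn ℂ f {z : ℂ | ρ₁ < ‖z‖ ∧ ‖z‖ < ρ₂})
    (hr₁ : ρ₁ < r₁) (hr₂ : r₂ < ρ₂) {w : ℂ} (hw₁ : r₁ < ‖w‖) (hw₂ : ‖w‖ < r₂) :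
    f w = gPlus f r₂ w + gMinus f r₁ w⁻¹ := by
  rw [cauchy_annulus hρ₁ hf hr₁ hr₂ hw₁ hw₂, sub_eq_add_neg, inner_eq_gMinus f (hρ₁.trans_lt hr₁) hw₁]
  rfl

/-- **`g⁺` is holomorphic on the disc `|w| < r₂`** (power series of the Cauchy integral), for `f` continuous on
the circle `|z| = r₂`. [cite: Balaban1987RG1, §5 p.294] -/
theorem differentiableOn_gPlus {f : ℂ → ℂ} {r₂ : ℝ} (hr₂ : 0 < r₂) (hf : ContinuousOn f (sphere 0 r₂)) :
    DifferentiableOn ℂ (gPlus f r₂) (ball 0 r₂) := by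
  have hci : CircleIntegrable f 0 ((r₂.toNNReal : NNReal) : ℝ) := by
    rw [Real.coe_toNNReal _ hr₂.le]; exact hf.circleIntegrable hr₂.le
  have h := (hasFPowerSeriesOn_cauchy_integral hci (Real.toNNReal_pos.2 hr₂)).differentiableOn
  rw [Metric.eball_coe, Real.coe_toNNReal _ hr₂.le] at h
  have hfun : (fun w => (2 * π * I : ℂ)⁻¹ • ∮ z in C(0, r₂), (z - w)⁻¹ • f z) = gPlus f r₂ := by
    funext w; simp only [gPlus, smul_eq_mul]
  rwa [hfun] at h

/-- **`g⁻` is holomorphic on the disc `|u| < r₁⁻¹`**, for `f` continuous on the circle `|z| = r₁`.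
[cite: Balaban1987RG1, §5 p.294] -/
theorem differentiableOn_gMinus {f : ℂ → ℂ} {r₁ : ℝ} (hr₁ : 0 < r₁) (hf : ContinuousOn f (sphere 0 r₁)) :
    DifferentiableOn ℂ (gMinus f r₁) (ball 0 r₁⁻¹) := by
  -- the integrand `F(ζ) = ζ⁻¹ f(ζ⁻¹)` is continuous on the circle of radius `r₁⁻¹`
  have hmaps : MapsTo (fun ζ : ℂ => ζ⁻¹) (sphere (0 : ℂ) r₁⁻¹) (sphere 0 r₁) := by
    intro ζ hζ
    simp only [mem_sphere, dist_zero_right] at hζ ⊢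
    rw [norm_inv, hζ, inv_inv]
  have h0 : ∀ ζ ∈ sphere (0 : ℂ) r₁⁻¹, ζ ≠ 0 := by
    intro ζ hζ h
    simp only [mem_sphere, dist_zero_right] at hζ
    rw [h, norm_zero] at hζ; exact (inv_pos.2 hr₁).ne hζ
  have hinv : ContinuousOn (fun ζ : ℂ => ζ⁻¹) (sphere (0 : ℂ) r₁⁻¹) := continuousOn_inv₀.mono fun ζ hζ => h0 ζ hζ
  have hF : ContinuousOn (fun ζ : ℂ => ζ⁻¹ * f ζ⁻¹) (sphere (0 : ℂ) r₁⁻¹) := hinv.mul (hf.comp hinv hmaps)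
  have hr : 0 < r₁⁻¹ := inv_pos.2 hr₁
  have hci : CircleIntegrable (fun ζ : ℂ => ζ⁻¹ * f ζ⁻¹) 0 ((r₁⁻¹.toNNReal : NNReal) : ℝ) := by
    rw [Real.coe_toNNReal _ hr.le]; exact hF.circleIntegrable hr.le
  have h := (hasFPowerSeriesOn_cauchy_integral hci (Real.toNNReal_pos.2 hr)).differentiableOn
  rw [Metric.eball_coe, Real.coe_toNNReal _ hr.le] at h
  have hfun : (fun u => u * ((2 * π * I : ℂ)⁻¹ • ∮ z in C(0, r₁⁻¹), (z - u)⁻¹ • (z⁻¹ * f z⁻¹)))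
      = gMinus f r₁ := by
    funext u; simp only [gMinus, smul_eq_mul]
  rw [← hfun]
  exact differentiableOn_id.mul h

/-! ## 4. Uniqueness «up to a constant» -/

/-- **UNIQUENESS up to a constant** (p. 294 «This representation is determined uniquely up to a constant»): if
`g⁺`, `g⁻` are holomorphic on the disc `|z| < R` (`R > 1`) and `g⁺(z) + g⁻(z⁻¹) = 0` on the ring `R⁻¹ < |z| < R`,
then `g⁺ ≡ g⁺(0)` and `g⁻ ≡ −g⁺(0)` on the disc (glue `g⁺` inside and `−g⁻(1/·)` outside the unit circle into a
bounded entire function; Liouville). [cite: Balaban1987RG1, §5 p.294] -/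
theorem laurent_unique_const {R : ℝ} (hR : 1 < R) {gp gm : ℂ → ℂ}
    (hgp : DifferentiableOn ℂ gp (ball 0 R)) (hgm : DifferentiableOn ℂ gm (ball 0 R))
    (h : ∀ z : ℂ, R⁻¹ < ‖z‖ → ‖z‖ < R → gp z + gm z⁻¹ = 0) :
    (∀ z ∈ ball (0 : ℂ) R, gp z = gp 0) ∧ (∀ u ∈ ball (0 : ℂ) R, gm u = -gp 0) := by
  have hR0 : 0 < R := by linarith
  have hRinv : R⁻¹ < 1 := inv_lt_one_of_one_lt₀ hR
  set Φ : ℂ → ℂ := fun z => if ‖z‖ ≤ 1 then gp z else -gm z⁻¹ with hΦ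
  have hΦφ : ∀ z : ℂ, ‖z‖ < R → Φ z = gp z := by
    intro z hz
    by_cases h1 : ‖z‖ ≤ 1
    · simp [hΦ, h1]
    · push Not at h1
      have := h z (by linarith) hz
      simp only [hΦ, not_le.mpr h1, if_false]
      linear_combination -this
  have hΦψ : ∀ z : ℂ, R⁻¹ < ‖z‖ → Φ z = -gm z⁻¹ := by
    intro z hz
    by_cases h1 : ‖z‖ ≤ 1
    · have := h z hz (by linarith)
      simp only [hΦ, h1, if_true]
      linear_combination this
    · simp [hΦ, h1]
  -- Φ is entire
  have hdiff : Differentiable ℂ Φ := by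
    intro z
    by_cases hz : ‖z‖ < R
    · have hφz : DifferentiableAt ℂ gp z := hgp.differentiableAt (isOpen_ball.mem_nhds (by simpa using hz))
      refine hφz.congr_of_eventuallyEq ?_
      have hev : ∀ᶠ w in 𝓝 z, ‖w‖ < R := (isOpen_lt continuous_norm continuous_const).mem_nhds hz
      exact hev.mono fun w hw => hΦφ w hw
    · push Not at hz
      have hz1 : 1 < ‖z‖ := lt_of_lt_of_le hR hz
      have hz0 : z ≠ 0 := by intro h0; rw [h0] at hz1; simp at hz1; linarith
      have hzi : ‖z⁻¹‖ < R := by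
        rw [norm_inv]
        calc ‖z‖⁻¹ ≤ R⁻¹ := inv_anti₀ hR0 hz
          _ < R := by linarith
      have hψzi : DifferentiableAt ℂ gm z⁻¹ := hgm.differentiableAt (isOpen_ball.mem_nhds (by simpa using hzi))
      have hinv : DifferentiableAt ℂ (fun w : ℂ => w⁻¹) z := (differentiableAt_id).inv hz0
      have hcomp : DifferentiableAt ℂ (fun w : ℂ => -gm w⁻¹) z := (hψzi.comp z hinv).neg
      refine hcomp.congr_of_eventuallyEq ?_
      have hev : ∀ᶠ w in 𝓝 z, 1 < ‖w‖ := (isOpen_lt continuous_const continuous_norm).mem_nhds hz1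
      exact hev.mono fun w hw => hΦψ w (hRinv.trans hw)
  -- Φ is bounded
  have hsub : closedBall (0 : ℂ) 1 ⊆ ball 0 R := closedBall_subset_ball hR
  obtain ⟨M₁, hM₁⟩ := (isCompact_closedBall (0 : ℂ) 1).exists_bound_of_continuousOn (hgp.continuousOn.mono hsub)
  obtain ⟨M₂, hM₂⟩ := (isCompact_closedBall (0 : ℂ) 1).exists_bound_of_continuousOn (hgm.continuousOn.mono hsub)
  have hbdd : Bornology.IsBounded (Set.range Φ) := by
    rw [isBounded_iff_forall_norm_le]
    refine ⟨max M₁ M₂, ?_⟩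
    rintro _ ⟨z, rfl⟩
    by_cases h1 : ‖z‖ ≤ 1
    · rw [show Φ z = gp z by simp [hΦ, h1]]
      exact (hM₁ z (by simpa using h1)).trans (le_max_left _ _)
    · push Not at h1
      rw [hΦψ z (hRinv.trans h1), norm_neg]
      refine (hM₂ _ ?_).trans (le_max_right _ _)
      simp only [mem_closedBall, dist_zero_right, norm_inv]
      exact inv_le_one_of_one_le₀ h1.le
  -- Liouville
  have hconst := hdiff.apply_eq_apply_of_bounded hbdd
  have hΦ0 : Φ 0 = gp 0 := by simp [hΦ]
  refine ⟨fun z hz => ?_, fun u hu => ?_⟩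
  · have hzR : ‖z‖ < R := by simpa using hz
    rw [← hΦφ z hzR, hconst z 0, hΦ0]
  · have huR : ‖u‖ < R := by simpa using hu
    -- on the punctured disc `gm u = −Φ(u⁻¹) = −gp 0`; at `u = 0` by continuity
    have hpunct : ∀ v : ℂ, v ≠ 0 → ‖v‖ < R → gm v = -gp 0 := by
      intro v hv0 hvR
      have hvi : R⁻¹ < ‖v⁻¹‖ := by
        rw [norm_inv]; exact (inv_lt_inv₀ hR0 (norm_pos_iff.2 hv0)).2 hvR
      have := hΦψ v⁻¹ hvi
      rw [inv_inv, hconst v⁻¹ 0, hΦ0] at this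
      linear_combination this
    by_cases hu0 : u = 0
    · subst hu0
      have hcont : ContinuousAt gm 0 :=
        (hgm.differentiableAt (isOpen_ball.mem_nhds (mem_ball_self hR0))).continuousAt
      have hev : gm =ᶠ[𝓝[≠] (0 : ℂ)] fun _ => -gp 0 := by
        have hball : ∀ᶠ v in 𝓝[≠] (0 : ℂ), ‖v‖ < R :=
          mem_nhdsWithin_of_mem_nhds ((isOpen_lt continuous_norm continuous_const).mem_nhds (by simpa using hR0))
        filter_upwards [hball, self_mem_nhdsWithin] with v hv hv0
        exact hpunct v hv0 hv
      have h1 : Tendsto gm (𝓝[≠] (0 : ℂ)) (𝓝 (gm 0)) := hcont.continuousWithinAt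
      have h2 : Tendsto gm (𝓝[≠] (0 : ℂ)) (𝓝 (-gp 0)) := (tendsto_congr' hev).2 tendsto_const_nhds
      exact tendsto_nhds_unique h1 h2
    · exact hpunct u hu0 huR

/-- Uniqueness under the normalization «g⁻(0) = 0»: a decomposition of `0` on the ring with `g⁻(0) = 0` is
trivial. [cite: Balaban1987RG1, §5 p.294] -/
theorem laurent_unique_of_norm_minus {R : ℝ} (hR : 1 < R) {gp gm : ℂ → ℂ}
    (hgp : DifferentiableOn ℂ gp (ball 0 R)) (hgm : DifferentiableOn ℂ gm (ball 0 R))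
    (h : ∀ z : ℂ, R⁻¹ < ‖z‖ → ‖z‖ < R → gp z + gm z⁻¹ = 0) (hnorm : gm 0 = 0) :
    (∀ z ∈ ball (0 : ℂ) R, gp z = 0) ∧ (∀ u ∈ ball (0 : ℂ) R, gm u = 0) := by
  obtain ⟨h1, h2⟩ := laurent_unique_const hR hgp hgm h
  have h0 : gp 0 = 0 := by
    have := h2 0 (mem_ball_self (by linarith)); rw [hnorm] at this; linear_combination this
  exact ⟨fun z hz => (h1 z hz).trans h0, fun u hu => by rw [h2 u hu, h0, neg_zero]⟩

/-- Uniqueness under the normalization «g⁺(0) = 0». [cite: Balaban1987RG1, §5 p.294] -/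
theorem laurent_unique_of_norm_plus {R : ℝ} (hR : 1 < R) {gp gm : ℂ → ℂ}
    (hgp : DifferentiableOn ℂ gp (ball 0 R)) (hgm : DifferentiableOn ℂ gm (ball 0 R))
    (h : ∀ z : ℂ, R⁻¹ < ‖z‖ → ‖z‖ < R → gp z + gm z⁻¹ = 0) (hnorm : gp 0 = 0) :
    (∀ z ∈ ball (0 : ℂ) R, gp z = 0) ∧ (∀ u ∈ ball (0 : ℂ) R, gm u = 0) := by
  obtain ⟨h1, h2⟩ := laurent_unique_const hR hgp hgm h
  exact ⟨fun z hz => (h1 z hz).trans hnorm, fun u hu => by rw [h2 u hu, hnorm, neg_zero]⟩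

/-- Uniqueness under the normalization «g⁺(0) = g⁻(0)». [cite: Balaban1987RG1, §5 p.294] -/
theorem laurent_unique_of_norm_eq {R : ℝ} (hR : 1 < R) {gp gm : ℂ → ℂ}
    (hgp : DifferentiableOn ℂ gp (ball 0 R)) (hgm : DifferentiableOn ℂ gm (ball 0 R))
    (h : ∀ z : ℂ, R⁻¹ < ‖z‖ → ‖z‖ < R → gp z + gm z⁻¹ = 0) (hnorm : gp 0 = gm 0) :
    (∀ z ∈ ball (0 : ℂ) R, gp z = 0) ∧ (∀ u ∈ ball (0 : ℂ) R, gm u = 0) := by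
  obtain ⟨h1, h2⟩ := laurent_unique_const hR hgp hgm h
  have h0 : gp 0 = 0 := by
    have := h2 0 (mem_ball_self (by linarith)); rw [← hnorm] at this; linear_combination this / 2
  exact ⟨fun z hz => (h1 z hz).trans h0, fun u hu => by rw [h2 u hu, h0, neg_zero]⟩

/-! ## 5. The three transformation laws of p. 294 -/

/-- `dslope g 0` (`= g(u)/u` off `0` when `g(0) = 0`, `= g′(0)` at `0`) is holomorphic on the disc when `g` is.
[cite: Balaban1987RG1, §5 p.294] -/
theorem differentiableOn_dslope_zero {g : ℂ → ℂ} {R : ℝ} (hR : 0 < R) (hg : DifferentiableOn ℂ g (ball 0 R)) :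
    DifferentiableOn ℂ (dslope g 0) (ball 0 R) := by
  intro u hu
  by_cases h0 : u = 0
  · subst h0
    have han : AnalyticAt ℂ g 0 := hg.analyticAt (isOpen_ball.mem_nhds (mem_ball_self hR))
    obtain ⟨p, hp⟩ := han
    exact hp.has_fpower_series_dslope_fslope.analyticAt.differentiableAt.differentiableWithinAt
  · exact ((differentiableAt_dslope_of_ne h0).2
      (hg.differentiableAt (isOpen_ball.mem_nhds hu))).differentiableWithinAt

/-- `dslope g 0 u = u⁻¹ g(u)` for `u ≠ 0` when `g(0) = 0`. [cite: Balaban1987RG1, §5 p.294] -/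
theorem dslope_zero_eq {g : ℂ → ℂ} (hg0 : g 0 = 0) {u : ℂ} (hu : u ≠ 0) : dslope g 0 u = u⁻¹ * g u := by
  rw [dslope_of_ne g hu, slope_def_field, hg0, sub_zero, sub_zero, div_eq_inv_mul]

/-- **Law S** (index ∉ {μ, ν}): if `f(z⁻¹) = f(z)` on the ring, `f = g⁺ + g⁻(1/·)` there, `g^±` holomorphic on the
disc and `g⁺(0) = g⁻(0)`, then `g⁻ = g⁺` («and we have the representation f(z) = g(z) + g(z⁻¹)»).
[cite: Balaban1987RG1, §5 p.294] -/
theorem law_S {R : ℝ} (hR : 1 < R) {f gp gm : ℂ → ℂ}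
    (hgp : DifferentiableOn ℂ gp (ball 0 R)) (hgm : DifferentiableOn ℂ gm (ball 0 R))
    (hdec : ∀ z : ℂ, R⁻¹ < ‖z‖ → ‖z‖ < R → f z = gp z + gm z⁻¹)
    (hlaw : ∀ z : ℂ, R⁻¹ < ‖z‖ → ‖z‖ < R → f z⁻¹ = f z) (hnorm : gp 0 = gm 0) :
    ∀ z ∈ ball (0 : ℂ) R, gm z = gp z := by
  have hR0 : 0 < R := by linarith
  have hring_inv : ∀ z : ℂ, R⁻¹ < ‖z‖ → ‖z‖ < R → R⁻¹ < ‖z⁻¹‖ ∧ ‖z⁻¹‖ < R := by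
    intro z h1 h2
    have hz0 : 0 < ‖z‖ := (inv_pos.2 hR0).trans h1
    rw [norm_inv]
    exact ⟨(inv_lt_inv₀ hR0 hz0).2 h2, by simpa using (inv_lt_inv₀ hz0 (inv_pos.2 hR0)).2 h1⟩
  have key := laurent_unique_of_norm_plus hR (gp := fun z => gp z - gm z) (gm := fun z => gm z - gp z)
    (hgp.sub hgm) (hgm.sub hgp) (fun z h1 h2 => by
      obtain ⟨h3, h4⟩ := hring_inv z h1 h2
      have e1 := hdec z h1 h2
      have e2 := hdec z⁻¹ h3 h4
      rw [inv_inv] at e2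
      have e3 := hlaw z h1 h2
      linear_combination -e3 - e1 + e2) (by simp [hnorm])
  intro z hz
  have := key.1 z hz
  linear_combination -this

/-- **Law N** (index = ν): if `f(z⁻¹) = −z f(z)` on the ring, `f = g⁺ + g⁻(1/·)` there, `g^±` holomorphic on the
disc and `g⁻(0) = 0`, then `g⁻(z) = −z g⁺(z)` («f(z) = g(z) − z⁻¹g(z⁻¹)»).  The auxiliary decomposition uses
`u⁻¹g⁻(u) = dslope g⁻ 0`, holomorphic because `g⁻(0) = 0`. [cite: Balaban1987RG1, §5 p.294] -/
theorem law_N {R : ℝ} (hR : 1 < R) {f gp gm : ℂ → ℂ}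
    (hgp : DifferentiableOn ℂ gp (ball 0 R)) (hgm : DifferentiableOn ℂ gm (ball 0 R))
    (hdec : ∀ z : ℂ, R⁻¹ < ‖z‖ → ‖z‖ < R → f z = gp z + gm z⁻¹)
    (hlaw : ∀ z : ℂ, R⁻¹ < ‖z‖ → ‖z‖ < R → f z⁻¹ = -z * f z) (hnorm : gm 0 = 0) :
    ∀ z ∈ ball (0 : ℂ) R, gm z = -z * gp z := by
  have hR0 : 0 < R := by linarith
  have hring_inv : ∀ z : ℂ, R⁻¹ < ‖z‖ → ‖z‖ < R → R⁻¹ < ‖z⁻¹‖ ∧ ‖z⁻¹‖ < R := by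
    intro z h1 h2
    have hz0 : 0 < ‖z‖ := (inv_pos.2 hR0).trans h1
    rw [norm_inv]
    exact ⟨(inv_lt_inv₀ hR0 hz0).2 h2, by simpa using (inv_lt_inv₀ hz0 (inv_pos.2 hR0)).2 h1⟩
  -- `G⁺(z) = g⁻(z) + z g⁺(z)`, `G⁻(u) = g⁺(u) + dslope g⁻ 0 u` (= g⁺(u) + u⁻¹g⁻(u) off 0)
  have key := laurent_unique_of_norm_plus hR (gp := fun z => gm z + z * gp z)
    (gm := fun u => gp u + dslope gm 0 u)
    (hgm.add (differentiableOn_id.mul hgp)) (hgp.add (differentiableOn_dslope_zero hR0 hgm))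
    (fun z h1 h2 => by
      obtain ⟨h3, h4⟩ := hring_inv z h1 h2
      have hz0 : z ≠ 0 := by intro h; rw [h, norm_zero] at h1; exact (inv_pos.2 hR0).not_gt h1
      have e1 := hdec z h1 h2
      have e2 := hdec z⁻¹ h3 h4
      rw [inv_inv] at e2
      have e3 := hlaw z h1 h2
      rw [dslope_zero_eq hnorm (inv_ne_zero hz0), inv_inv]
      linear_combination e3 - e2 - z * e1) (by simp [hnorm])
  intro z hz
  have := key.1 z hz
  linear_combination this

/-- **Law M** (index = μ): if `f(z⁻¹) = −z⁻¹ f(z)` on the ring, `f = g⁺ + g⁻(1/·)` there, `g^±` holomorphic on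
the disc and `g⁺(0) = 0`, then `g⁺(z) = −z g⁻(z)`, i.e. «g⁻(z) = −z⁻¹g⁺(z), and we have f(z) = g(z) − zg(z⁻¹)».
[cite: Balaban1987RG1, §5 p.294] -/
theorem law_M {R : ℝ} (hR : 1 < R) {f gp gm : ℂ → ℂ}
    (hgp : DifferentiableOn ℂ gp (ball 0 R)) (hgm : DifferentiableOn ℂ gm (ball 0 R))
    (hdec : ∀ z : ℂ, R⁻¹ < ‖z‖ → ‖z‖ < R → f z = gp z + gm z⁻¹)
    (hlaw : ∀ z : ℂ, R⁻¹ < ‖z‖ → ‖z‖ < R → f z⁻¹ = -z⁻¹ * f z) (hnorm : gp 0 = 0) :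
    ∀ z ∈ ball (0 : ℂ) R, gp z = -z * gm z := by
  have hR0 : 0 < R := by linarith
  have hring_inv : ∀ z : ℂ, R⁻¹ < ‖z‖ → ‖z‖ < R → R⁻¹ < ‖z⁻¹‖ ∧ ‖z⁻¹‖ < R := by
    intro z h1 h2
    have hz0 : 0 < ‖z‖ := (inv_pos.2 hR0).trans h1
    rw [norm_inv]
    exact ⟨(inv_lt_inv₀ hR0 hz0).2 h2, by simpa using (inv_lt_inv₀ hz0 (inv_pos.2 hR0)).2 h1⟩
  -- `G⁺(z) = g⁻(z) + dslope g⁺ 0 z` (= g⁻(z) + z⁻¹g⁺(z) off 0), `G⁻(u) = g⁺(u) + u g⁻(u)`; normalization G⁻(0) = 0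
  have key := laurent_unique_of_norm_minus hR (gp := fun z => gm z + dslope gp 0 z)
    (gm := fun u => gp u + u * gm u)
    (hgm.add (differentiableOn_dslope_zero hR0 hgp)) (hgp.add (differentiableOn_id.mul hgm))
    (fun z h1 h2 => by
      obtain ⟨h3, h4⟩ := hring_inv z h1 h2
      have hz0 : z ≠ 0 := by intro h; rw [h, norm_zero] at h1; exact (inv_pos.2 hR0).not_gt h1
      have e1 := hdec z h1 h2
      have e2 := hdec z⁻¹ h3 h4
      rw [inv_inv] at e2
      have e3 := hlaw z h1 h2
      rw [dslope_zero_eq hnorm hz0]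
      linear_combination e3 - e2 - z⁻¹ * e1) (by simp [hnorm])
  intro z hz
  have := key.2 z hz
  linear_combination this

end

end Literature.MathematicalPhysics.QuantumFieldTheory.Balaban1983to89.B12LaurentSplit522
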